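/-
Copyright (c) 2026 the pub-hodgecm-mathlib formalisation cell (harness21).  Prover seat hodgecm-mathlib-K2E1-p11 (g6), Track B ∕ K2-LIT, h413 = `stmt-HodgeConjecture-24833`,
R90-TF section S8 «ContSpec-n½», the `hsrc` supplier estate, RULING J-S8-ω (S8 dealer R90-CS-plan (g4), S8-R313 (c) «ONE DEFINITION, TWO COROLLARIES»; deal S8-R240 (2) ∕ S8-R282
«letter-free core»), FILE (ε-B) — COROLLARY TWO: ★ p864821's SIX LOCAL LETTERS `hωc hω1 hωS₀ hΩ hin hsp` AT THE MOVED BASE POINT `b₁ = w₀^{S₀}` FOR THE SAME WEIGHT FAMILY (★ FILE (α)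
at `k_f := b₁`), with the pair (Θ-twisted) reading of K2E1-p13's ★ `hsrc16_of_coreLetters_at` under the one level letter `hψS₀` (★ W10 p865504).
-/
import Summits.HodgeConjecture.HodgeConjecture.Theorems.K2E1ChiDescriptiveWeightTokensU3     -- ★ p865570 (this seat, FILE (γ)); brings ★ FILE (α) p865535, ★ FILE (β) p865561, ★ p865059, ★ p864965
import Summits.HodgeConjecture.HodgeConjecture.Theorems.K2E1ChiLevelBallInBoxU3              -- ★ p865233 (this seat): `hbox_of_level` (the level ball lies in the box)
import Summits.HodgeConjecture.HodgeConjecture.Theorems.R90S8TorusDictLocalUnitsPsiFactorU3  -- ★ p865504 (K2E3-p26 (g4), W10): `detChar_finReading_const`, `detChar_finPart_weylLongU_mul_eq_one_of_offIntegralTorus`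
import HarnessLib

/-!
# K2·E1 ∕ R90·S8 — `K2E1ChiWeightPairRowsAtBasePointU3` (RULING J-S8-ω, COROLLARY TWO): ★ p864821's SIX LOCAL LETTERS AT THE MOVED BASE POINT, LETTER-FREE

Cell `pub/hodgecm-mathlib`, crux h413 = `stmt-HodgeConjecture-24833`, route of record `HCCMUnconditional`; R90-TF section S8 «ContSpec-n½», (V-1) row `hsrc` paid through ★ p864821
`hsrc_of_record_at_basePoint_of_core` ∘ K2E1-p13's ★ `hsrc16_of_coreLetters_at` (p865365), whose binders `ω hωc hω1 hωS₀ hΩ hin hsp` this file DELIVERS for the untwisted finite factor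
`Φf` at `b₁ = w₀^{S₀}` (★ p865348), with the pair reading `Φf·(Θ∘ι_f)` under `hψS₀` (★ W10).  THEOREMS ONLY (no `def`, no `instance`, no `notation`, no named-fact hypothesis, no `sorry`;
default heartbeats); lane `--supports stmt-HodgeConjecture-24833 --as helper` (count-neutral).  Closes no socket.

THE MATHEMATICS ([PlatonovRapinchuk1994] §5.1; [BorelJacquet1979] §4.1; [Rogawski1990] §1.10 p. 9, §13.3 p. 202, §13.9 p. 229; [Langlands1971] §3; [MoeglinWaldspurger1995] II.1.6–7).
Take ★ FILE (α)'s descriptive family at `k_f := b₁`, `ω_v(x|_v) = Φf(ι^{(v)}((ι(w₀)·n(x)·b₁)_v))`, where `b₁` has components `Φ₃` above `S₀` and `1` off `S₀` (★ p865348).  OFF `S₀`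
(`|𝔫|_w = 1`): `(b₁)_v = 1 ∈ K_v(𝔫)`, so ★ FILE (γ) gives `hω1 hin hsp`; ★ FILE (β) gives `hωc`; ★ FILE (α) gives `hΩ`.  ABOVE `S₀` (`𝔭_w ∣ 𝔫`, `|𝔫|_w ≤ |2|_w`, `|𝔫|_w ≤ |2δ|_w`): the
component `Φ₃·n(x|_v)·Φ₃` is lower unitriangular (★ p865059): on the level ball it lies in `K_v(𝔫)` and `ω_v = 1` (★ FILE (α) unit reading), off the ball it lies off `B_v·K_v(𝔫)` and `ω_v = 0`
(★ FILE (α) «off»); the ball lies in the box (★ p865233); hence **`ω_v = 𝟙{p ∈ 𝒪_v³ ∧ ball}`** as functions — ★ p864821's `hωS₀`, STRUCTURALLY.  PAIR READING: `Θ(ι_f((ι(w₀)·n(x))_f·b₁)) =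
Θ(ι_f((ι(w₀))_f·b₁)) = 1` (★ W10 `detChar_finReading_const`, `detChar_finPart_weylLongU_mul_eq_one_of_offIntegralTorus` under `hψS₀`), so `Φf(…)·Θ(ι_f(…)) = ∏ᶠ_v ω_v(x|_v)` — K2E1-p13's
`hΩ` binder with `Φf := φ₀ ∘ ι_f`.
* §1 `descriptiveWeight_eq_indicator_of_antidiag` (above `S₀`: `ω_v` IS the indicator), `coe_evalPlace_mem_level_of_eq_one`.
* §2 HEAD **`exists_weight_pair_rows_at_basePoint`** — `∃ ω` with ★ p864821's six letters + the Θ-twisted `hΩ`.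
HONEST LABEL: HC_CM is proved only modulo the 7 printed citations (2 remaining named inputs: hLiu418 = `stmt-HodgeConjecture-24832`, h413 = `stmt-HodgeConjecture-24833`) until rung 0
closes; REL ≠ ★ ≠ BUILT; unconditional; asserts no named fact, closes no socket; visible = frame + finite factor's level facts + `hgood` + level hypotheses of record on∕off `S₀` + base point
clauses (★ p865348) + `hψS₀`; count-neutral.

## References
* [PlatonovRapinchuk1994] V. Platonov, A. Rapinchuk, *Algebraic Groups and Number Theory* (1994), §5.1.
* [BorelJacquet1979] A. Borel, H. Jacquet, *Automorphic forms and automorphic representations*, PSPM 33.1 (1979), §4.1.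
* [Rogawski1990] J. D. Rogawski, *Automorphic Representations of Unitary Groups in Three Variables*, Ann. of Math. Stud. 123 (1990), §1.10 p. 9, §13.3 p. 202, §13.9 p. 229.
* [Langlands1971] R. P. Langlands, *Euler Products* (1971), §3.
* [MoeglinWaldspurger1995] C. Mœglin, J.-L. Waldspurger, *Spectral Decomposition and Eisenstein Series* (1995), II.1.6–II.1.7.
-/

set_option autoImplicit false
set_option linter.dupNamespace false  -- the mandated namespace repeats the summit's segment (`HodgeConjecture.HodgeConjecture`)

noncomputable section

open MeasureTheory NumberField IsDedekindDomain Filter Set Function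
open scoped NNReal
open Literature.NumberTheory.GaloisRepresentations Literature.NumberTheory.GaloisRepresentations.HeckeCharacter
open Literature.NumberTheory.GaloisRepresentations.IsNonarchimedeanLocalField
open Literature.NumberTheory.Automorphic Literature.NumberTheory.Automorphic.UnitaryGroup AdelicGroupData
open Literature.NumberTheory.Automorphic.Arthur2013.Leaves.TECR
open Literature.NumberTheory.Automorphic.UnitaryGroup.AdelicCharactersDetQuasiSplit (antidiagonal_over_det_ne_zero)
open Summit.HodgeConjecture.HodgeConjecture.Cruxes.H413.K2E1CharacterEisensteinU2Defs
open Summit.HodgeConjecture.HodgeConjecture.Cruxes.H413.K2E1CharacterEisensteinU3PairDefs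
open Summit.HodgeConjecture.HodgeConjecture.Cruxes.H413.K2E1ChiDescriptiveWeightU3 (exists_finiteAdele_apply_eq apply_inclPlace_eq_zero_of_forall_ne apply_inclPlace_eq_one_of_mem_level exists_descriptiveWeight hΩ_of_descriptiveWeight)
open Summit.HodgeConjecture.HodgeConjecture.Cruxes.H413.K2E1ChiDescriptiveWeightContinuityU3 (hωc_of_descriptiveWeight)
open Summit.HodgeConjecture.HodgeConjecture.Cruxes.H413.K2E1ChiDescriptiveWeightTokensU3 (descriptiveWeight_rows_inert descriptiveWeight_rows_split)
open Summit.HodgeConjecture.HodgeConjecture.Cruxes.H413.K2E1ChiBadPlaceReadingU3 (badPlace_localReading_on badPlace_localReading_off)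
open Summit.HodgeConjecture.HodgeConjecture.Cruxes.H413.K2E1ChiLevelBallInBoxU3 (hbox_of_level)
open Summit.HodgeConjecture.HodgeConjecture.Cruxes.H413.R90S8TorusDictLocalUnitsPsiFactorU3 (detChar_finReading_const detChar_finPart_weylLongU_mul_eq_one_of_offIntegralTorus)

namespace Summit.HodgeConjecture.HodgeConjecture.Cruxes.H413.K2E1ChiWeightPairRowsAtBasePointU3

variable (L : Type) [Field L] [NumberField L] [IsCMField L] (hc : IsCMField.complexConj L * IsCMField.complexConj L = 1)
  {δ : L} (hcδ : IsCMField.complexConj L δ = -δ) (hδ : δ ≠ 0) {d : ↥(maximalRealSubfield L)} (hd : δ * δ = algebraMap ↥(maximalRealSubfield L) L d)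

/-! ## §1 Above `S₀` the descriptive weight at the moved base point IS the indicator of the level ball -/

/-- **ABOVE `S₀`: `ω_v = 𝟙{p ∈ 𝒪_v³ ∧ ball(p)}`** for the descriptive weight at a translate `b₁` with `((b₁)_v)_w = Φ₃`, `|𝔫|_w < 1`, and the ball inside the box: on the ball the lower
unitriangular component lies in `K_v(𝔫)` (★ p865059 `badPlace_localReading_on`) and `Φf(ι^{(v)}·) = 1` (★ FILE (α)); off the ball it lies off `B_v·K_v(𝔫)` (★ `badPlace_localReading_off`) and
`Φf(ι^{(v)}·) = 0`. [cite: Rogawski1990, §1.10 p. 9] [cite: PlatonovRapinchuk1994, §5.1] [cite: BorelJacquet1979, §4.1] -/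
theorem descriptiveWeight_eq_indicator_of_antidiag (χ : HeckeCharacter L) (𝔫 : Ideal (𝓞 L))
    (Φf : ↥(finAdelic (↥(maximalRealSubfield L)) L (IsCMField.complexConj L) 3 ((StdForm.antidiagonal 3).over L)) → ℂ)
    (hon : ∀ (b k : ↥(finAdelic (↥(maximalRealSubfield L)) L (IsCMField.complexConj L) 3 ((StdForm.antidiagonal 3).over L)))
        (hb : finAdelicToAdelic (↥(maximalRealSubfield L)) L (IsCMField.complexConj L) 3 ((StdForm.antidiagonal 3).over L) b ∈ borelAdelic (↥(maximalRealSubfield L)) L (IsCMField.complexConj L) 3),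
        k ∈ finCongruenceLevel (↥(maximalRealSubfield L)) L (IsCMField.complexConj L) 3 ((StdForm.antidiagonal 3).over L) 𝔫 →
        Φf (b * k) = ((χ (firstEntryUnit hb) : ℂˣ) : ℂ) * (((1 : ↥(TorusDict.torus (IsCMField.complexConj L)) →ₜ* ℂˣ) (middleEntryUnitary hb) : ℂˣ) : ℂ))
    (hoff : ∀ u : ↥(finAdelic (↥(maximalRealSubfield L)) L (IsCMField.complexConj L) 3 ((StdForm.antidiagonal 3).over L)),
      (∀ (b k : ↥(finAdelic (↥(maximalRealSubfield L)) L (IsCMField.complexConj L) 3 ((StdForm.antidiagonal 3).over L))),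
          finAdelicToAdelic (↥(maximalRealSubfield L)) L (IsCMField.complexConj L) 3 ((StdForm.antidiagonal 3).over L) b ∈ borelAdelic (↥(maximalRealSubfield L)) L (IsCMField.complexConj L) 3 →
            k ∈ finCongruenceLevel (↥(maximalRealSubfield L)) L (IsCMField.complexConj L) 3 ((StdForm.antidiagonal 3).over L) 𝔫 → u ≠ b * k) → Φf u = 0)
    (b₁ : ↥(finAdelic (↥(maximalRealSubfield L)) L (IsCMField.complexConj L) 3 ((StdForm.antidiagonal 3).over L))) (v : HeightOneSpectrum (𝓞 ↥(maximalRealSubfield L)))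
    (hb₁ : ∀ w : PlacesOver L v, ((((evalPlace (↥(maximalRealSubfield L)) L (IsCMField.complexConj L) 3 ((StdForm.antidiagonal 3).over L) v b₁ : localPi L (IsCMField.complexConj L) 3 ((StdForm.antidiagonal 3).over L) v) : LocalGLPi L 3 v) w :
      GL (Fin 3) (w.1.adicCompletion L)) : Matrix (Fin 3) (Fin 3) (w.1.adicCompletion L)) = !![0, 0, 1; 0, 1, 0; 1, 0, 0])
    (h𝔫 : ∀ w : PlacesOver L v, idealRadius L w.1 𝔫 < 1)
    (hbox : ∀ p : Fin 3 → v.adicCompletion ↥(maximalRealSubfield L), (∀ w' : PlacesOver L v,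
              Valued.v (quadraticLocalEquiv L v (IsCMField.complexConj L) hcδ hδ (p 0, p 1) w') ≤ idealRadius L w'.1 𝔫 ∧
              Valued.v (conjLocal L (IsCMField.complexConj L) v (quadraticLocalEquiv L v (IsCMField.complexConj L) hcδ hδ (p 0, p 1)) w') ≤ idealRadius L w'.1 𝔫 ∧
              Valued.v ((toLocalRing L v (p 2) * algebraMap L (LocalRing L v) δ -
                toLocalRing L v 2⁻¹ * (quadraticLocalEquiv L v (IsCMField.complexConj L) hcδ hδ (p 0, p 1) * conjLocal L (IsCMField.complexConj L) v (quadraticLocalEquiv L v (IsCMField.complexConj L) hcδ hδ (p 0, p 1)))) w') ≤ idealRadius L w'.1 𝔫) →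
            p ∈ integralBox ↥(maximalRealSubfield L) (Fin 3) v)
    (ω : (Fin 3 → v.adicCompletion ↥(maximalRealSubfield L)) → ℂ)
    (hω : ∀ x : Fin 3 → FiniteAdeleRing (𝓞 ↥(maximalRealSubfield L)) ↥(maximalRealSubfield L),
      ω (fun i => x i v) = Φf (inclPlace (↥(maximalRealSubfield L)) L (IsCMField.complexConj L) 3 ((StdForm.antidiagonal 3).over L) v
        (evalPlace (↥(maximalRealSubfield L)) L (IsCMField.complexConj L) 3 ((StdForm.antidiagonal 3).over L) v
          (finPart (↥(maximalRealSubfield L)) L (IsCMField.complexConj L) 3 ((StdForm.antidiagonal 3).over L)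
            ((quasiSplit (↥(maximalRealSubfield L)) L (IsCMField.complexConj L) 3).toAdelic (weylLongU ((IsCMField.complexConj L : L ≃ₐ[↥(maximalRealSubfield L)] L) : L →+* L) (rfl : (StdForm.antidiagonal 3).over L = (StdForm.antidiagonal 3).over L)) *
              ((heisChart hc (((((0 : InfiniteAdeleRing L)), quadraticFiniteAdeleMap ↥(maximalRealSubfield L) L δ (x 0, x 1)) : AdeleRing (𝓞 L) L),
                traceZeroLine ↥(maximalRealSubfield L) L (IsCMField.complexConj L) hcδ hδ ((0, x 2) : AdeleRing (𝓞 ↥(maximalRealSubfield L)) ↥(maximalRealSubfield L))) :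
                  ↥(adelicUnipotent ↥(maximalRealSubfield L) L (IsCMField.complexConj L) 3)) : (quasiSplit (↥(maximalRealSubfield L)) L (IsCMField.complexConj L) 3).Adelic)) * b₁)))) :
    ω = Set.indicator {p : Fin 3 → v.adicCompletion ↥(maximalRealSubfield L) | p ∈ integralBox ↥(maximalRealSubfield L) (Fin 3) v ∧ ∀ w' : PlacesOver L v,
              Valued.v (quadraticLocalEquiv L v (IsCMField.complexConj L) hcδ hδ (p 0, p 1) w') ≤ idealRadius L w'.1 𝔫 ∧
              Valued.v (conjLocal L (IsCMField.complexConj L) v (quadraticLocalEquiv L v (IsCMField.complexConj L) hcδ hδ (p 0, p 1)) w') ≤ idealRadius L w'.1 𝔫 ∧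
              Valued.v ((toLocalRing L v (p 2) * algebraMap L (LocalRing L v) δ -
                toLocalRing L v 2⁻¹ * (quadraticLocalEquiv L v (IsCMField.complexConj L) hcδ hδ (p 0, p 1) * conjLocal L (IsCMField.complexConj L) v (quadraticLocalEquiv L v (IsCMField.complexConj L) hcδ hδ (p 0, p 1)))) w') ≤ idealRadius L w'.1 𝔫}
            (fun _ => (1 : ℂ)) := by
  funext p
  obtain ⟨x, hx⟩ := exists_finiteAdele_apply_eq L v p
  have hxv : (fun i => x i v) = p := funext hx
  rw [← hxv, hω x]
  by_cases hball : ∀ w : PlacesOver L v,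
      Valued.v (quadraticLocalEquiv L v (IsCMField.complexConj L) hcδ hδ (x 0 v, x 1 v) w) ≤ idealRadius L w.1 𝔫 ∧
      Valued.v (conjLocal L (IsCMField.complexConj L) v (quadraticLocalEquiv L v (IsCMField.complexConj L) hcδ hδ (x 0 v, x 1 v)) w) ≤ idealRadius L w.1 𝔫 ∧
      Valued.v ((toLocalRing L v (x 2 v) * algebraMap L (LocalRing L v) δ -
        toLocalRing L v 2⁻¹ * (quadraticLocalEquiv L v (IsCMField.complexConj L) hcδ hδ (x 0 v, x 1 v) *
          conjLocal L (IsCMField.complexConj L) v (quadraticLocalEquiv L v (IsCMField.complexConj L) hcδ hδ (x 0 v, x 1 v)))) w) ≤ idealRadius L w.1 𝔫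
  · -- on the ball: the component lies in `K_v(𝔫)`, the factor reads `1`
    have hmem : (fun i => x i v) ∈ {p : Fin 3 → v.adicCompletion ↥(maximalRealSubfield L) | p ∈ integralBox ↥(maximalRealSubfield L) (Fin 3) v ∧ ∀ w' : PlacesOver L v,
              Valued.v (quadraticLocalEquiv L v (IsCMField.complexConj L) hcδ hδ (p 0, p 1) w') ≤ idealRadius L w'.1 𝔫 ∧
              Valued.v (conjLocal L (IsCMField.complexConj L) v (quadraticLocalEquiv L v (IsCMField.complexConj L) hcδ hδ (p 0, p 1)) w') ≤ idealRadius L w'.1 𝔫 ∧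
              Valued.v ((toLocalRing L v (p 2) * algebraMap L (LocalRing L v) δ -
                toLocalRing L v 2⁻¹ * (quadraticLocalEquiv L v (IsCMField.complexConj L) hcδ hδ (p 0, p 1) * conjLocal L (IsCMField.complexConj L) v (quadraticLocalEquiv L v (IsCMField.complexConj L) hcδ hδ (p 0, p 1)))) w') ≤ idealRadius L w'.1 𝔫} :=
      ⟨hbox _ hball, hball⟩
    rw [Set.indicator_of_mem hmem]
    exact apply_inclPlace_eq_one_of_mem_level L χ 𝔫 Φf v hon (badPlace_localReading_on L hc hcδ hδ 𝔫 x b₁ v hb₁ h𝔫 hball).2.1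
  · -- off the ball: the component lies off `B_v·K_v(𝔫)`, the factor reads `0`
    rw [Set.indicator_of_notMem (fun h => hball h.2)]
    exact apply_inclPlace_eq_zero_of_forall_ne L 𝔫 Φf v hoff (badPlace_localReading_off L hc hcδ hδ 𝔫 x b₁ v hb₁ h𝔫 hball)

/-- A translate with `((b₁)_v)_w = 1` for all `w ∣ v` has `(b₁)_v ∈ K_v(𝔫)` (indeed `(b₁)_v = 1`). [cite: PlatonovRapinchuk1994, §5.1] -/
theorem coe_evalPlace_mem_level_of_eq_one (𝔫 : Ideal (𝓞 L)) (b₁ : ↥(finAdelic (↥(maximalRealSubfield L)) L (IsCMField.complexConj L) 3 ((StdForm.antidiagonal 3).over L)))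
    (v : HeightOneSpectrum (𝓞 ↥(maximalRealSubfield L)))
    (hb₁ : ∀ w : PlacesOver L v, ((((evalPlace (↥(maximalRealSubfield L)) L (IsCMField.complexConj L) 3 ((StdForm.antidiagonal 3).over L) v b₁ : localPi L (IsCMField.complexConj L) 3 ((StdForm.antidiagonal 3).over L) v) : LocalGLPi L 3 v) w :
      GL (Fin 3) (w.1.adicCompletion L)) : Matrix (Fin 3) (Fin 3) (w.1.adicCompletion L)) = 1) (w : PlacesOver L v) :
    ((evalPlace (↥(maximalRealSubfield L)) L (IsCMField.complexConj L) 3 ((StdForm.antidiagonal 3).over L) v b₁ : localPi L (IsCMField.complexConj L) 3 ((StdForm.antidiagonal 3).over L) v) : LocalGLPi L 3 v) w ∈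
      valuedCongruenceSubgroup (Fin 3) (idealRadius L w.1 𝔫) := by
  have h : ((evalPlace (↥(maximalRealSubfield L)) L (IsCMField.complexConj L) 3 ((StdForm.antidiagonal 3).over L) v b₁ : localPi L (IsCMField.complexConj L) 3 ((StdForm.antidiagonal 3).over L) v) : LocalGLPi L 3 v) w = 1 :=
    Units.ext (by rw [hb₁ w, Units.val_one])
  rw [h]
  exact one_mem _

/-! ## §2 HEAD: ★ p864821's six local letters at the moved base point, for the descriptive family at `b₁` -/

section Head

variable [∀ v : HeightOneSpectrum (𝓞 ↥(maximalRealSubfield L)), MeasurableSpace (v.adicCompletion ↥(maximalRealSubfield L))]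
  [∀ v : HeightOneSpectrum (𝓞 ↥(maximalRealSubfield L)), BorelSpace (v.adicCompletion ↥(maximalRealSubfield L))]
  (νv : ∀ v : HeightOneSpectrum (𝓞 ↥(maximalRealSubfield L)), Measure (v.adicCompletion ↥(maximalRealSubfield L))) [∀ v, (νv v).IsAddHaarMeasure]

include hd in
/-- **HEAD — COROLLARY TWO OF J-S8-ω: ★ p864821's SIX LOCAL LETTERS AT THE MOVED BASE POINT, LETTER-FREE.**  `Φf` with the level law at `(φ, 1, K_f(𝔫))`, `φ` unitary, `𝔫 ≠ 0`; `S₀` with `hgood`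
and the level hypotheses of record (`|𝔫|_w = 1` off `S₀`; above `S₀`: `|𝔫|_w < 1`, `|𝔫|_w ≤ |2|_w`, `|𝔫|_w ≤ |2|_w|δ|_w`); a translate `b₁` with components `Φ₃` above `S₀` and `1` off `S₀` (★ p865348);
an automorphic torus character `ψ` killing the off-`S₀` integral torus (`hψS₀`).  THEN there is ONE weight `ω` (★ FILE (α)'s family at `k_f := b₁`) with: `hωc` (★ FILE (β)), `hω1` (★ FILE (γ)),
`hωS₀` (§1: the indicator of the level ball, FUNEXT), `hΩ` untwisted (★ FILE (α)) AND Θ-twisted — K2E1-p13's binder `Φf(u)·Θ(ι_f u) = ∏ᶠ_v ω_v` at `u = (ι(w₀)·n(x))_f·b₁` (★ W10) —, `hin`,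
`hsp` (★ FILE (γ)). [cite: PlatonovRapinchuk1994, §5.1] [cite: BorelJacquet1979, §4.1] [cite: Rogawski1990, §1.10 p. 9, §13.3 p. 202, §13.9 p. 229] [cite: Langlands1971, §3]
[cite: MoeglinWaldspurger1995, II.1.6–II.1.7] -/
theorem exists_weight_pair_rows_at_basePoint {φ : HeckeCharacter L} (hφ : φ.IsUnitary) {𝔫 : Ideal (𝓞 L)} (h𝔫 : 𝔫 ≠ 0)
    (Φf : ↥(finAdelic (↥(maximalRealSubfield L)) L (IsCMField.complexConj L) 3 ((StdForm.antidiagonal 3).over L)) → ℂ)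
    (hon : ∀ (b k : ↥(finAdelic (↥(maximalRealSubfield L)) L (IsCMField.complexConj L) 3 ((StdForm.antidiagonal 3).over L)))
        (hb : finAdelicToAdelic (↥(maximalRealSubfield L)) L (IsCMField.complexConj L) 3 ((StdForm.antidiagonal 3).over L) b ∈ borelAdelic (↥(maximalRealSubfield L)) L (IsCMField.complexConj L) 3),
        k ∈ finCongruenceLevel (↥(maximalRealSubfield L)) L (IsCMField.complexConj L) 3 ((StdForm.antidiagonal 3).over L) 𝔫 →
        Φf (b * k) = ((φ (firstEntryUnit hb) : ℂˣ) : ℂ) * (((1 : ↥(TorusDict.torus (IsCMField.complexConj L)) →ₜ* ℂˣ) (middleEntryUnitary hb) : ℂˣ) : ℂ))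
    (hoff : ∀ u : ↥(finAdelic (↥(maximalRealSubfield L)) L (IsCMField.complexConj L) 3 ((StdForm.antidiagonal 3).over L)),
      (∀ (b k : ↥(finAdelic (↥(maximalRealSubfield L)) L (IsCMField.complexConj L) 3 ((StdForm.antidiagonal 3).over L))),
          finAdelicToAdelic (↥(maximalRealSubfield L)) L (IsCMField.complexConj L) 3 ((StdForm.antidiagonal 3).over L) b ∈ borelAdelic (↥(maximalRealSubfield L)) L (IsCMField.complexConj L) 3 →
            k ∈ finCongruenceLevel (↥(maximalRealSubfield L)) L (IsCMField.complexConj L) 3 ((StdForm.antidiagonal 3).over L) 𝔫 → u ≠ b * k) → Φf u = 0)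
    (hK : ∀ u, ∀ k ∈ finCongruenceLevel (↥(maximalRealSubfield L)) L (IsCMField.complexConj L) 3 ((StdForm.antidiagonal 3).over L) 𝔫, Φf (u * k) = Φf u)
    (S₀ : Finset (HeightOneSpectrum (𝓞 ↥(maximalRealSubfield L))))
    (hgood : ∀ v ∉ S₀, (Algebra.IsUnramifiedIn (𝓞 L) v.asIdeal ∧ Valued.v (2 : v.adicCompletion ↥(maximalRealSubfield L)) = 1 ∧
        ∀ w : PlacesOver L v, Valued.v (algebraMap L (LocalRing L v) δ w) = 1) ∧ ∀ w : PlacesOver L v, φ.IsUnramifiedAt w.1)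
    (h𝔫S₀ : ∀ v ∉ S₀, ∀ w : PlacesOver L v, idealRadius L w.1 𝔫 = 1)
    (h𝔫bad : ∀ v ∈ S₀, ∀ w : PlacesOver L v, idealRadius L w.1 𝔫 < 1)
    (h2bad : ∀ v ∈ S₀, ∀ w : PlacesOver L v, idealRadius L w.1 𝔫 ≤ Valued.v (toLocalRing L v 2 w))
    (h2δbad : ∀ v ∈ S₀, ∀ w : PlacesOver L v, idealRadius L w.1 𝔫 ≤ Valued.v (toLocalRing L v 2 w) * Valued.v (algebraMap L (LocalRing L v) δ w))
    {b₁ : ↥(finAdelic (↥(maximalRealSubfield L)) L (IsCMField.complexConj L) 3 ((StdForm.antidiagonal 3).over L))}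
    (hb₁S₀ : ∀ v ∈ S₀, ∀ w : PlacesOver L v, ((((evalPlace (↥(maximalRealSubfield L)) L (IsCMField.complexConj L) 3 ((StdForm.antidiagonal 3).over L) v b₁ :
        localPi L (IsCMField.complexConj L) 3 ((StdForm.antidiagonal 3).over L) v) : LocalGLPi L 3 v) w : GL (Fin 3) (w.1.adicCompletion L)) : Matrix (Fin 3) (Fin 3) (w.1.adicCompletion L)) =
      !![0, 0, 1; 0, 1, 0; 1, 0, 0])
    (hb₁off : ∀ v ∉ S₀, ∀ w : PlacesOver L v, ((((evalPlace (↥(maximalRealSubfield L)) L (IsCMField.complexConj L) 3 ((StdForm.antidiagonal 3).over L) v b₁ :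
        localPi L (IsCMField.complexConj L) 3 ((StdForm.antidiagonal 3).over L) v) : LocalGLPi L 3 v) w : GL (Fin 3) (w.1.adicCompletion L)) : Matrix (Fin 3) (Fin 3) (w.1.adicCompletion L)) = 1)
    -- the Θ-twist data (K2E1-p13's pair reading): an automorphic torus character killing the off-`S₀` integral torus
    (h2 : Module.finrank (↥(maximalRealSubfield L)) L = 2) (hc1 : IsCMField.complexConj L ≠ 1)
    (ψ : ↥(TorusDict.torus (IsCMField.complexConj L)) →ₜ* ℂˣ) (hψ : TorusDict.IsAutomorphic (IsCMField.complexConj L) ψ)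
    (hψS₀ : ∀ t : ↥(TorusDict.torus (IsCMField.complexConj L)), ((t : ideleGroup L) : AdeleRing (𝓞 L) L).1 = 1 →
      (∀ w : HeightOneSpectrum (𝓞 L), w.under (𝓞 ↥(maximalRealSubfield L)) ∈ S₀ → ((t : ideleGroup L) : AdeleRing (𝓞 L) L).2 w = 1) →
      (∀ w : HeightOneSpectrum (𝓞 L), Valued.v (((t : ideleGroup L) : AdeleRing (𝓞 L) L).2 w) = 1) → ψ t = 1) :
    ∃ ω : ∀ v : HeightOneSpectrum (𝓞 ↥(maximalRealSubfield L)), (Fin 3 → v.adicCompletion ↥(maximalRealSubfield L)) → ℂ,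
      -- `hωc`
      (∀ z : ℂ, 2 < z.re → ∀ v, Continuous fun p : Fin 3 → v.adicCompletion ↥(maximalRealSubfield L) =>
        ω v p * (((∏ w' : PlacesOver L v, max 1 (max ((normAbs (w'.1.adicCompletion L) (quadraticLocalEquiv L v (IsCMField.complexConj L) hcδ hδ (p 0, p 1) w') : ℝ≥0) : ℝ)
            ((normAbs (w'.1.adicCompletion L) ((toLocalRing L v (p 2) * algebraMap L (LocalRing L v) δ -
              toLocalRing L v 2⁻¹ * (quadraticLocalEquiv L v (IsCMField.complexConj L) hcδ hδ (p 0, p 1) *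
                conjLocal L (IsCMField.complexConj L) v (quadraticLocalEquiv L v (IsCMField.complexConj L) hcδ hδ (p 0, p 1)))) w') : ℝ≥0) : ℝ))) : ℝ) : ℂ) ^ (-z)) ∧
      -- `hω1`
      (∀ v ∉ S₀, ∀ p ∈ integralBox ↥(maximalRealSubfield L) (Fin 3) v, ω v p = 1) ∧
      -- `hωS₀`
      (∀ v ∈ S₀, ω v = Set.indicator {p : Fin 3 → v.adicCompletion ↥(maximalRealSubfield L) | p ∈ integralBox ↥(maximalRealSubfield L) (Fin 3) v ∧ ∀ w' : PlacesOver L v,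
              Valued.v (quadraticLocalEquiv L v (IsCMField.complexConj L) hcδ hδ (p 0, p 1) w') ≤ idealRadius L w'.1 𝔫 ∧
              Valued.v (conjLocal L (IsCMField.complexConj L) v (quadraticLocalEquiv L v (IsCMField.complexConj L) hcδ hδ (p 0, p 1)) w') ≤ idealRadius L w'.1 𝔫 ∧
              Valued.v ((toLocalRing L v (p 2) * algebraMap L (LocalRing L v) δ -
                toLocalRing L v 2⁻¹ * (quadraticLocalEquiv L v (IsCMField.complexConj L) hcδ hδ (p 0, p 1) * conjLocal L (IsCMField.complexConj L) v (quadraticLocalEquiv L v (IsCMField.complexConj L) hcδ hδ (p 0, p 1)))) w') ≤ idealRadius L w'.1 𝔫}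
            (fun _ => (1 : ℂ))) ∧
      -- `hΩ` (untwisted)
      (∀ x : Fin 3 → FiniteAdeleRing (𝓞 ↥(maximalRealSubfield L)) ↥(maximalRealSubfield L),
        Φf (finPart (↥(maximalRealSubfield L)) L (IsCMField.complexConj L) 3 ((StdForm.antidiagonal 3).over L)
            ((quasiSplit (↥(maximalRealSubfield L)) L (IsCMField.complexConj L) 3).toAdelic (weylLongU ((IsCMField.complexConj L : L ≃ₐ[↥(maximalRealSubfield L)] L) : L →+* L) (rfl : (StdForm.antidiagonal 3).over L = (StdForm.antidiagonal 3).over L)) *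
              ((heisChart hc (((((0 : InfiniteAdeleRing L)), quadraticFiniteAdeleMap ↥(maximalRealSubfield L) L δ (x 0, x 1)) : AdeleRing (𝓞 L) L),
                traceZeroLine ↥(maximalRealSubfield L) L (IsCMField.complexConj L) hcδ hδ ((0, x 2) : AdeleRing (𝓞 ↥(maximalRealSubfield L)) ↥(maximalRealSubfield L))) :
                  ↥(adelicUnipotent ↥(maximalRealSubfield L) L (IsCMField.complexConj L) 3)) : (quasiSplit (↥(maximalRealSubfield L)) L (IsCMField.complexConj L) 3).Adelic)) * b₁) =
          ∏ᶠ v : HeightOneSpectrum (𝓞 ↥(maximalRealSubfield L)), ω v (fun i => x i v)) ∧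
      -- `hΩ` (Θ-twisted: K2E1-p13's binder with `Φf := φ₀ ∘ ι_f`)
      (∀ x : Fin 3 → FiniteAdeleRing (𝓞 ↥(maximalRealSubfield L)) ↥(maximalRealSubfield L),
        Φf (finPart (↥(maximalRealSubfield L)) L (IsCMField.complexConj L) 3 ((StdForm.antidiagonal 3).over L)
            ((quasiSplit (↥(maximalRealSubfield L)) L (IsCMField.complexConj L) 3).toAdelic (weylLongU ((IsCMField.complexConj L : L ≃ₐ[↥(maximalRealSubfield L)] L) : L →+* L) (rfl : (StdForm.antidiagonal 3).over L = (StdForm.antidiagonal 3).over L)) *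
              ((heisChart hc (((((0 : InfiniteAdeleRing L)), quadraticFiniteAdeleMap ↥(maximalRealSubfield L) L δ (x 0, x 1)) : AdeleRing (𝓞 L) L),
                traceZeroLine ↥(maximalRealSubfield L) L (IsCMField.complexConj L) hcδ hδ ((0, x 2) : AdeleRing (𝓞 ↥(maximalRealSubfield L)) ↥(maximalRealSubfield L))) :
                  ↥(adelicUnipotent ↥(maximalRealSubfield L) L (IsCMField.complexConj L) 3)) : (quasiSplit (↥(maximalRealSubfield L)) L (IsCMField.complexConj L) 3).Adelic)) * b₁) *
          ((detChar (↥(maximalRealSubfield L)) L (IsCMField.complexConj L) h2 hc1 3 ((StdForm.antidiagonal 3).over L) ψ hψ (antidiagonal_over_det_ne_zero L 3)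
            (finAdelicToAdelic (↥(maximalRealSubfield L)) L (IsCMField.complexConj L) 3 ((StdForm.antidiagonal 3).over L)
              (finPart (↥(maximalRealSubfield L)) L (IsCMField.complexConj L) 3 ((StdForm.antidiagonal 3).over L)
                ((quasiSplit (↥(maximalRealSubfield L)) L (IsCMField.complexConj L) 3).toAdelic (weylLongU ((IsCMField.complexConj L : L ≃ₐ[↥(maximalRealSubfield L)] L) : L →+* L) (rfl : (StdForm.antidiagonal 3).over L = (StdForm.antidiagonal 3).over L)) *
                  ((heisChart hc (((((0 : InfiniteAdeleRing L)), quadraticFiniteAdeleMap ↥(maximalRealSubfield L) L δ (x 0, x 1)) : AdeleRing (𝓞 L) L),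
                    traceZeroLine ↥(maximalRealSubfield L) L (IsCMField.complexConj L) hcδ hδ ((0, x 2) : AdeleRing (𝓞 ↥(maximalRealSubfield L)) ↥(maximalRealSubfield L))) :
                      ↥(adelicUnipotent ↥(maximalRealSubfield L) L (IsCMField.complexConj L) 3)) : (quasiSplit (↥(maximalRealSubfield L)) L (IsCMField.complexConj L) 3).Adelic)) * b₁)) : ℂˣ) : ℂ) =
          ∏ᶠ v : HeightOneSpectrum (𝓞 ↥(maximalRealSubfield L)), ω v (fun i => x i v)) ∧
      -- `hin`
      (∀ z : ℂ, 2 < z.re → ∀ v ∉ S₀, ∀ w : PlacesOver L v, IsCMField.complexConj L • w.1 = w.1 →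
        ((Measure.pi fun _ : Fin 3 => νv v) (integralBox ↥(maximalRealSubfield L) (Fin 3) v)).toReal⁻¹ •
            ∫ p : Fin 3 → v.adicCompletion ↥(maximalRealSubfield L),
              ω v p * (((∏ w' : PlacesOver L v, max 1 (max ((normAbs (w'.1.adicCompletion L) (quadraticLocalEquiv L v (IsCMField.complexConj L) hcδ hδ (p 0, p 1) w') : ℝ≥0) : ℝ)
                ((normAbs (w'.1.adicCompletion L) ((toLocalRing L v (p 2) * algebraMap L (LocalRing L v) δ -
                  toLocalRing L v 2⁻¹ * (quadraticLocalEquiv L v (IsCMField.complexConj L) hcδ hδ (p 0, p 1) *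
                    conjLocal L (IsCMField.complexConj L) v (quadraticLocalEquiv L v (IsCMField.complexConj L) hcδ hδ (p 0, p 1)))) w') : ℝ≥0) : ℝ))) : ℝ) : ℂ) ^ (-z)
              ∂(Measure.pi fun _ : Fin 3 => νv v) =
          (1 - φ.valueAtUniformizer w.1 * (v.residueCard : ℂ) ^ (-(2 * z))) * (1 + φ.valueAtUniformizer w.1 * (v.residueCard : ℂ) ^ (-(2 * z - 1))) /
            ((1 - φ.valueAtUniformizer w.1 * (v.residueCard : ℂ) ^ (-(2 * z - 2))) * (1 + φ.valueAtUniformizer w.1 * (v.residueCard : ℂ) ^ (-(2 * z - 2))))) ∧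
      -- `hsp`
      (∀ z : ℂ, 2 < z.re → ∀ v ∉ S₀, ∀ w : PlacesOver L v, IsCMField.complexConj L • w.1 ≠ w.1 →
        ((Measure.pi fun _ : Fin 3 => νv v) (integralBox ↥(maximalRealSubfield L) (Fin 3) v)).toReal⁻¹ •
            ∫ p : Fin 3 → v.adicCompletion ↥(maximalRealSubfield L),
              ω v p * (((∏ w' : PlacesOver L v, max 1 (max ((normAbs (w'.1.adicCompletion L) (quadraticLocalEquiv L v (IsCMField.complexConj L) hcδ hδ (p 0, p 1) w') : ℝ≥0) : ℝ)
                ((normAbs (w'.1.adicCompletion L) ((toLocalRing L v (p 2) * algebraMap L (LocalRing L v) δ -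
                  toLocalRing L v 2⁻¹ * (quadraticLocalEquiv L v (IsCMField.complexConj L) hcδ hδ (p 0, p 1) *
                    conjLocal L (IsCMField.complexConj L) v (quadraticLocalEquiv L v (IsCMField.complexConj L) hcδ hδ (p 0, p 1)))) w') : ℝ≥0) : ℝ))) : ℝ) : ℂ) ^ (-z)
              ∂(Measure.pi fun _ : Fin 3 => νv v) =
          (1 - φ.valueAtUniformizer w.1 * (v.residueCard : ℂ) ^ (-z)) * (1 - φ.valueAtUniformizer (PlacesOver.galInv (IsCMField.complexConj L) w).1 * (v.residueCard : ℂ) ^ (-z)) *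
              (1 - φ.valueAtUniformizer w.1 * φ.valueAtUniformizer (PlacesOver.galInv (IsCMField.complexConj L) w).1 * (v.residueCard : ℂ) ^ (-(2 * z - 1))) /
            ((1 - φ.valueAtUniformizer w.1 * (v.residueCard : ℂ) ^ (-(z - 1))) * (1 - φ.valueAtUniformizer (PlacesOver.galInv (IsCMField.complexConj L) w).1 * (v.residueCard : ℂ) ^ (-(z - 1))) *
              (1 - φ.valueAtUniformizer w.1 * φ.valueAtUniformizer (PlacesOver.galInv (IsCMField.complexConj L) w).1 * (v.residueCard : ℂ) ^ (-(2 * z - 2))))) := by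
  -- ONE DEFINITION: ★ FILE (α)'s descriptive family at `k_f := b₁`
  obtain ⟨ωf, hωf⟩ := exists_descriptiveWeight L hc hcδ hδ Φf
  have hz1 : ∀ z : ℂ, 2 < z.re → 1 < z.re := fun z hz => by linarith
  -- the untwisted pure-tensor reading (★ FILE (α))
  have hΩ := hΩ_of_descriptiveWeight L hc hcδ hδ φ h𝔫 Φf hon hoff b₁ (ωf b₁) (hωf b₁)
  refine ⟨ωf b₁, fun z _ v => ?_, fun v hv p hp => ?_, fun v hv => ?_, hΩ, fun x => ?_, fun z hz v hv w hw => ?_, fun z hz v hv w hw => ?_⟩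
  · -- `hωc`
    exact hωc_of_descriptiveWeight L hc hcδ hδ h𝔫 Φf hK b₁ v _ (hωf b₁ v) z
  · -- `hω1`
    obtain ⟨⟨hunr, h2', hδu⟩, hur⟩ := hgood v hv
    have hkf := coe_evalPlace_mem_level_of_eq_one L 𝔫 b₁ v (hb₁off v hv)
    obtain ⟨w⟩ := PlacesOver.nonempty L v
    by_cases hw : IsCMField.complexConj L • w.1 = w.1
    · exact (descriptiveWeight_rows_inert L hc hcδ hδ hd v (νv v) hφ 𝔫 Φf hon hK w hunr hw h2' hδu (hur w) (h𝔫S₀ v hv) b₁ hkf _ (hωf b₁ v)).2 p hp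
    · exact (descriptiveWeight_rows_split L hc hcδ hδ hd v (νv v) hφ 𝔫 Φf hon hK w hw h2' hδu hur (h𝔫S₀ v hv) b₁ hkf _ (hωf b₁ v)).2 p hp
  · -- `hωS₀`
    obtain ⟨w⟩ := PlacesOver.nonempty L v
    exact descriptiveWeight_eq_indicator_of_antidiag L hc hcδ hδ φ 𝔫 Φf hon hoff b₁ v (hb₁S₀ v hv) (h𝔫bad v hv)
      (hbox_of_level L hcδ hδ 𝔫 v w (h2bad v hv w) (h2δbad v hv w)) _ (hωf b₁ v)
  · -- `hΩ`, Θ-twisted: the Θ-factor is the constant `1` (★ W10)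
    rw [detChar_finReading_const, detChar_finPart_weylLongU_mul_eq_one_of_offIntegralTorus L h2 hc1 ψ hψ S₀ hψS₀ hb₁S₀ hb₁off, Units.val_one, mul_one]
    exact hΩ x
  · -- `hin`
    obtain ⟨⟨hunr, h2', hδu⟩, hur⟩ := hgood v hv
    exact (descriptiveWeight_rows_inert L hc hcδ hδ hd v (νv v) hφ 𝔫 Φf hon hK w hunr hw h2' hδu (hur w) (h𝔫S₀ v hv) b₁
      (coe_evalPlace_mem_level_of_eq_one L 𝔫 b₁ v (hb₁off v hv)) _ (hωf b₁ v)).1 z (hz1 z hz)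
  · -- `hsp`
    obtain ⟨⟨hunr, h2', hδu⟩, hur⟩ := hgood v hv
    exact (descriptiveWeight_rows_split L hc hcδ hδ hd v (νv v) hφ 𝔫 Φf hon hK w hw h2' hδu hur (h𝔫S₀ v hv) b₁
      (coe_evalPlace_mem_level_of_eq_one L 𝔫 b₁ v (hb₁off v hv)) _ (hωf b₁ v)).1 z (hz1 z hz) w hw

end Head

end Summit.HodgeConjecture.HodgeConjecture.Cruxes.H413.K2E1ChiWeightPairRowsAtBasePointU3

end
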